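import Summits.QuantumFields.YangMills.Theorems.ColdStartUniversalityShenZhuZhuRectangleConcentrationSU2
import HarnessLib

/-!
# Rectangular Wilson loops `W_{R×T}` ON THE TORUS `(ℤ/L)³` in the tree's finite-volume vocabulary (`wilsonMeasure`, `wilsonLoop`,
# `wilsonExpectation`): Gaussian concentration at the perimeter scale for every `L > max(R, T)`, `SU(2)`, tree coupling `|β'| < 1/12`

Seat `ym-line-csu-p1` (g38), route `ColdStartUniversality` of `Summits/QuantumFields/YangMills`, helper file G9 — the finite-volume rectangle
theorem of G8 (`torus_rectangle_twoSided_su2_uniform`, which reads the `ℤ³`-rectangle through the periodic lift and carries the hypothesis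
that its links stay distinct on the torus) restated for the torus' OWN rectangular Wilson loop `wilsonLoop ρ x i j R T`
(`ConstructiveQFTWave0`, `rectangleHolonomy`) at an arbitrary torus base point, with that hypothesis DISCHARGED for `R, T < L`.

* `exists_offsets_dir_of_mem_walkEdges_rectWalk` (every `d`) — the links of `rectWalk x i j R T` are `(x + a e_i + b e_j, k)` with
  `a ≤ R`, `b ≤ T`, `k ∈ {i, j}`.
* `injOn_torusEdge_walkEdges_rectWalk` (every `d`) — for `i ≠ j` and `R, T < L` these links are pairwise distinct on the torus `(ℤ/L)^d`.
* `wilsonLoopObs_rectWalk_torusLift` — `W_{rectWalk x i j R T}(torusLift V) = wilsonLoop ρ (proj x) i j R T V` (tree `walkHolonomy_rectWalk_eq`).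
* ★★★ `torus_wilsonLoop_rect_twoSided_su2` — for the periodic `SU(2)` Wilson measure `μ_{L,β'}` on `(ℤ/L)³` at tree coupling `|β'| < 1/12`,
  every `L`, every torus base point, every coordinate plane `i ≠ j`, all `1 ≤ R, T < L` and every `r ≥ 0`:
  `μ_{L,β'}{|W_{R×T} − ⟨W_{R×T}⟩_{L,β'}| ≥ r} ≤ 2 exp(−(1 − 12|β'|) r²/(2(R+T)))`, `W_{R×T} = wilsonLoop (fundamentalRep (Fin 2)) x i j R T`
  (`= ½ Re tr hol_{∂(R×T)}`), `⟨·⟩_{L,β'} = wilsonExpectation` — Gaussian error bars at the PERIMETER scale `√(R+T)`, the same in every volume.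

THEOREMS ONLY, no definition, no sorry.  HONEST FRAMING: STRONG coupling (`|β'| < 1/12` tree coupling = 't Hooft `1/24`), fixed lattice, `SU(2)`,
`d = 3`; no area law, nothing at weak coupling / in the continuum, nothing `K`-uniform along the route's scaling (`UniformColdStartMixing`,
24809, ASIDE, not restated); no crux, rung or summit statement is proved; the Yang–Mills mass gap is NOT proved.

References: H. Shen, R. Zhu, X. Zhu, CMP 400 (2023) 805–851 = arXiv:2204.12737, Thm 1.4, Cor. 1.5 [ShenZhuZhu2022].
-/

set_option autoImplicit false

noncomputable section

namespace Summit.QuantumFields.YangMills.Theorems.ColdStartUniversality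

open MeasureTheory ProbabilityTheory Finset Filter Set Function
open scoped BigOperators NNReal ENNReal Topology Matrix Matrix.Norms.Frobenius ContDiff
open SimpleGraph
open Literature.Probability.LatticeModels (Site zdGraph Torus.proj Torus.proj_apply)
open Literature.Probability.Process Literature.MathematicalPhysics.QuantumFieldTheory
open Literature.MathematicalPhysics.QuantumLattice (fundamentalRep fundamentalLatticeRep continuous_fundamentalRep fundamentalRep_apply
  torusEdge torusLift LGConfig normalisedCharacter dartStep dartStep_symm dartStep_add_single wilsonLoopObs walkHolonomy
  lineWalk rectWalk length_rectWalk walkHolonomy_rectWalk_eq)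
open Summit.Ventures.YMGap.RobustBall (dartMult)

/-! ## §1. The links of a lattice rectangle, and their distinctness on the torus -/

/-- **The links of a lattice rectangle**: every link of `rectWalk x i j R T` is `(x + a e_i + b e_j, k)` with `a ≤ R`, `b ≤ T` and direction
`k ∈ {i, j}` (the four sides are straight walks).  [folklore] -/
theorem exists_offsets_dir_of_mem_walkEdges_rectWalk {d : ℕ} {x : Site d} {i j : Fin d} {R T : ℕ}
    {e : Literature.MathematicalPhysics.QuantumLattice.ZdEdge d} (he : e ∈ walkEdges (rectWalk x i j R T)) :
    ∃ a b : ℕ, a ≤ R ∧ b ≤ T ∧ e.1 = x + Pi.single i (a : ℤ) + Pi.single j (b : ℤ) ∧ (e.2 = i ∨ e.2 = j) := by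
  classical
  -- the oriented edges of a straight walk (adapted from the venture file RobustBall/RectangleTrail.lean, not importable here)
  have hline : ∀ (k : Fin d) (n : ℕ) (y : Site d),
      ((lineWalk k n y).darts.map fun a => (dartStep a).1) =
        (List.range n).map fun m : ℕ => (y + Pi.single k (m : ℤ), k) := by
    intro k n
    induction n with
    | zero => intro y; simp [lineWalk]
    | succ n ih =>
      intro y
      rw [lineWalk, Walk.darts_cons, Walk.darts_copy, List.map_cons, dartStep_add_single, ih, List.range_succ_eq_map,
        List.map_cons, List.map_map]
      simp only [Nat.cast_zero, Pi.single_zero, add_zero]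
      congr 1
      refine List.map_congr_left fun m _ => ?_
      simp only [comp_apply, Nat.succ_eq_add_one, Nat.cast_add, Nat.cast_one, Pi.single_add]
      abel
  have hmem : ∀ (k : Fin d) (n : ℕ) (y : Site d) (e : Literature.MathematicalPhysics.QuantumLattice.ZdEdge d),
      e ∈ ((lineWalk k n y).darts.map fun a => (dartStep a).1) → ∃ m : ℕ, m < n ∧ e = (y + Pi.single k (m : ℤ), k) := by
    intro k n y e he
    rw [hline] at he
    obtain ⟨m, hm, hme⟩ := List.mem_map.1 he
    exact ⟨m, List.mem_range.1 hm, hme.symm⟩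
  have hrev : ∀ {y y' : Site d} (w : (zdGraph d).Walk y y'),
      (w.reverse.darts.map fun a => (dartStep a).1) = (w.darts.map fun a => (dartStep a).1).reverse := by
    intro y y' w
    rw [Walk.darts_reverse, List.map_reverse, List.map_map]
    congr 1
    exact List.map_congr_left fun a _ => by simp [dartStep_symm]
  unfold walkEdges at he
  rw [List.mem_toFinset, rectWalk, Walk.darts_append, Walk.darts_append, Walk.darts_append, List.map_append, List.map_append,
    List.map_append] at he
  rcases List.mem_append.1 he with hA | hBCD
  · obtain ⟨m, hm, rfl⟩ := hmem i R x e hA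
    exact ⟨m, 0, hm.le, Nat.zero_le _, by simp, Or.inl rfl⟩
  rcases List.mem_append.1 hBCD with hB | hCD
  · rw [Walk.darts_copy] at hB
    obtain ⟨m, hm, rfl⟩ := hmem j T _ e hB
    exact ⟨R, m, le_rfl, hm.le, rfl, Or.inr rfl⟩
  rcases List.mem_append.1 hCD with hC | hD
  · rw [hrev, List.mem_reverse] at hC
    obtain ⟨m, hm, rfl⟩ := hmem i R _ e hC
    exact ⟨m, T, hm.le, le_rfl, by simp only; rw [add_right_comm], Or.inl rfl⟩
  · rw [hrev, List.mem_reverse] at hD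
    obtain ⟨m, hm, rfl⟩ := hmem j T x e hD
    exact ⟨0, m, Nat.zero_le _, hm.le, by simp, Or.inr rfl⟩

/-- **The links of a lattice rectangle are pairwise distinct on the torus `(ℤ/L)^d` when `R, T < L`** (`i ≠ j`): `torusEdge L` is injective on
`links(rectWalk x i j R T)` (the `i`- and `j`-coordinates of the base points are `x_i + a`, `x_j + b` with `a ≤ R < L`, `b ≤ T < L`). [folklore] -/
theorem injOn_torusEdge_walkEdges_rectWalk {d : ℕ} (L : ℕ) (x : Site d) {i j : Fin d} (hij : i ≠ j) {R T : ℕ}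
    (hRL : R < L) (hTL : T < L) :
    Set.InjOn (torusEdge (d := d) L) ↑(walkEdges (rectWalk x i j R T)) := by
  intro e he e' he' hEq
  obtain ⟨a, b, ha, hb, h1, hdir⟩ := exists_offsets_dir_of_mem_walkEdges_rectWalk (Finset.mem_coe.1 he)
  obtain ⟨a', b', ha', hb', h1', hdir'⟩ := exists_offsets_dir_of_mem_walkEdges_rectWalk (Finset.mem_coe.1 he')
  have hEq' : (Torus.proj L e.1, e.2) = (Torus.proj L e'.1, e'.2) := hEq
  obtain ⟨hfst, hsnd⟩ := Prod.mk_inj.1 hEq'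
  -- the `i`-coordinate gives `a = a'`, the `j`-coordinate gives `b = b'`
  have hi := congrFun hfst i
  have hj := congrFun hfst j
  rw [Torus.proj_apply, Torus.proj_apply, h1, h1'] at hi hj
  simp only [Pi.add_apply, Pi.single_eq_same, Pi.single_eq_of_ne hij, Pi.single_eq_of_ne hij.symm, add_zero,
    Int.cast_add, Int.cast_natCast, add_right_inj] at hi hj
  have haa : a = a' := by
    have h := (ZMod.natCast_eq_natCast_iff' a a' L).1 hi
    rwa [Nat.mod_eq_of_lt (lt_of_le_of_lt ha hRL), Nat.mod_eq_of_lt (lt_of_le_of_lt ha' hRL)] at h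
  have hbb : b = b' := by
    have h := (ZMod.natCast_eq_natCast_iff' b b' L).1 hj
    rwa [Nat.mod_eq_of_lt (lt_of_le_of_lt hb hTL), Nat.mod_eq_of_lt (lt_of_le_of_lt hb' hTL)] at h
  subst haa hbb
  exact Prod.ext (h1.trans h1'.symm) hsnd

/-! ## §2. The torus' own rectangular Wilson loop -/

/-- **The lattice rectangle read through the periodic lift IS the torus' rectangular Wilson loop**: for every torus configuration `V`,
`W_{rectWalk x i j R T}(torusLift L V) = wilsonLoop (fundamentalRep (Fin N)) (proj x) i j R T V` (`= (1/N) Re tr` of the rectangle holonomy;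
tree `walkHolonomy_rectWalk_eq`). [folklore] -/
theorem wilsonLoopObs_rectWalk_torusLift {d N : ℕ} (L : ℕ) (x : Site d) (i j : Fin d) (R T : ℕ)
    (V : GaugeConfig d L (Matrix.specialUnitaryGroup (Fin N) ℂ)) :
    wilsonLoopObs (fun g : Matrix.specialUnitaryGroup (Fin N) ℂ => normalisedCharacter N (fundamentalRep (Fin N) g))
        (rectWalk x i j R T) (torusLift L V) =
      wilsonLoop (fundamentalRep (Fin N)) (Torus.proj L x) i j R T V := by
  unfold wilsonLoopObs wilsonLoop normalisedCharacter
  rw [walkHolonomy_rectWalk_eq]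

/-! ## §3. `SU(2)`, `d = 3`, `|β'| < 1/12`: Gaussian concentration of `W_{R×T}` on every torus -/

/-- ★★★ **Gaussian concentration of rectangular Wilson loops on every torus, in the tree's finite-volume vocabulary.**  For the periodic `SU(2)`
Wilson measure `μ_{L,β'} = wilsonMeasure (fundamentalRep (Fin 2)) β'` on `(ℤ/L)³` at tree coupling `|β'| < 1/12`, every torus base point `x`,
every coordinate plane `i ≠ j`, all side lengths `1 ≤ R < L`, `1 ≤ T < L`, and every `r ≥ 0`:
`μ_{L,β'}{V : r ≤ |W_{R×T}(V) − ⟨W_{R×T}⟩_{L,β'}|} ≤ 2 exp(−(1 − 12|β'|) r²/(2(R+T)))`, `W_{R×T} = wilsonLoop (fundamentalRep (Fin 2)) x i j R T`,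
`⟨·⟩_{L,β'} = wilsonExpectation (fundamentalRep (Fin 2)) β'` — Gaussian fluctuations at the perimeter scale `√(R+T)`, with the same constant in
every volume.  Strong coupling, fixed lattice; the Yang–Mills mass gap is NOT proved. [cite: ShenZhuZhu2022, Theorem 1.4, Corollary 1.5] -/
theorem torus_wilsonLoop_rect_twoSided_su2 {β' : ℝ} (hβ : |β'| < 1 / 12) (L : ℕ) [NeZero L]
    (x : Literature.MathematicalPhysics.QuantumFieldTheory.Site 3 L) {i j : Fin 3} (hij : i ≠ j) {R T : ℕ}
    (hR : 1 ≤ R) (hT : 1 ≤ T) (hRL : R < L) (hTL : T < L) {r : ℝ} (hr : 0 ≤ r) :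
    (wilsonMeasure (d := 3) (L := L) (fundamentalRep (Fin 2)) β').real
        {V | r ≤ |wilsonLoop (fundamentalRep (Fin 2)) x i j R T V -
          wilsonExpectation (d := 3) (L := L) (fundamentalRep (Fin 2)) β' (wilsonLoop (fundamentalRep (Fin 2)) x i j R T)|} ≤
      2 * Real.exp (-((1 - 12 * |β'|) * r ^ 2 / (2 * ((R : ℝ) + T)))) := by
  -- lift the base point to `ℤ³`
  set x₀ : Site 3 := fun k => ((x k).val : ℤ) with hx₀
  have hx : Torus.proj L x₀ = x := by
    funext k
    rw [Torus.proj_apply, hx₀]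
    simp only [Int.cast_natCast, ZMod.natCast_zmod_val]
  have hW : ∀ V : GaugeConfig 3 L (Matrix.specialUnitaryGroup (Fin 2) ℂ),
      wilsonLoopObs (fun g : Matrix.specialUnitaryGroup (Fin 2) ℂ => normalisedCharacter 2 (fundamentalRep (Fin 2) g))
          (rectWalk x₀ i j R T) (torusLift L V) =
        wilsonLoop (fundamentalRep (Fin 2)) x i j R T V := by
    intro V; rw [wilsonLoopObs_rectWalk_torusLift, hx]
  have h := torus_rectangle_twoSided_su2_uniform hβ L x₀ hij hR hT (injOn_torusEdge_walkEdges_rectWalk L x₀ hij hRL hTL) hr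
  simp_rw [hW] at h
  exact h

end Summit.QuantumFields.YangMills.Theorems.ColdStartUniversality

end
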